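import Literature.Combinatorics.SimpleGraph.MengerTheorem
import Literature.Probability.Percolation.ArmSeparationTubes
import Literature.Probability.Percolation.ArmEventsStructure
import HarnessLib

/-!
# Gluing monochromatic arm events through circuits: the Menger step (proofs only)

Topic `Literature/Probability/Percolation`; family `crit-perc` (site percolation on `𝕋`).
Deterministic bricks for the quasi-multiplicativity of the MONOCHROMATIC `k`-arm events
`armEvent (fun _ : Fin k => true) n N` (`ArmEvents.lean`: `k` pairwise vertex-disjoint open
self-avoiding paths of `𝕋` across the hexagonal annulus `Λ_N ∖ Λ_n`), i.e. the constant-colour case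
`σ = BB…B` of P. Nolin, *Near-critical percolation in two dimensions*, EJP 13 (2008), Prop. 17
[arXiv 0711.4948: Prop. 16] at `p = 1/2` (`MonochromaticArmQuasiMult.lean`). For one colour the
arm events are increasing, so Harris–FKG and RSW glue the pieces (Nolin, §6.2, footnote to the proof of
Thm. 27: for one arm "the extendability property, as well as the quasi-multiplicativity, are direct
consequences of RSW and do not require the separation lemmas"); for `k ≥ 2` arms of one colour the
only extra input is combinatorial — **Menger's theorem** (`Literature.Combinatorics.SimpleGraph.MengerTheorem`):
`k` disjoint open crossings of `Λ_{n₃} ∖ Λ_{n₁}` exist as soon as no `k - 1` open sites separate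
`∂Λ_{n₁}` from `∂Λ_{n₃}` in the open subgraph of the annulus, and a set of `k - 1` sites misses one
member of each family of `k` pairwise disjoint open pieces (inner arms, circuits, radial connectors,
outer arms), whose union then links `∂Λ_{n₁}` to `∂Λ_{n₃}`.

* `exists_forall_not_mem_of_card_lt` — pigeonhole: fewer than `k` sites miss one of `k` pairwise
  disjoint sets.
* `mem_armEvent_const_of_forall_link` — **the Menger step**: if every set `Z` of fewer than `k` sites is
  avoided by an open path of the closed annulus `{n₁ ≤ |·|_𝕋 ≤ n₃}` from `∂Λ_{n₁}` to `∂Λ_{n₃}`, then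
  `ω ∈ armEvent (fun _ : Fin k => true) n₁ n₃`.
* `mem_armEvent_const_of_crossings` — `k` open paths inside `k` pairwise disjoint regions, each from
  `Λ_{n₁}` to the outside of `Λ̊_{n₃}`, give the `k`-arm event (trimming + the Menger step).
* `mem_armEvent_const_glue` — **the gluing**: `k` inner arms (`Λ_{n₂} ∖ Λ_{n₁}`), `k` outer arms
  (`Λ_{n₃} ∖ Λ_{n₂}`), `k` open circuits in disjoint Euclidean annuli below `∂Λ_{n₂}` and `k` above it,
  and `k` open radial connectors in disjoint regions crossing all `2k` circuits, give `k` disjoint open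
  arms across `Λ_{n₃} ∖ Λ_{n₁}`.

## References

* P. Nolin, Near-critical percolation in two dimensions, *Electron. J. Probab.* 13 (2008) 1562–1623,
  §4.5 Prop. 16–17 and §6.2 (footnote) [arXiv 0711.4948: Prop. 15–16, Thm. 26] [Nolin2008].
* H. Kesten, Scaling relations for 2D-percolation, *Comm. Math. Phys.* 109 (1987) 109–156, §1 [Kesten1987].
* R. Diestel, *Graph Theory*, 5th ed. (2017), Thm. 3.3.1 (Menger) [Diestel2017].

Tree: `armEvent`, `triAnnulus`, `mem_triAnnulus` (`ArmEventsProofs.lean`), `PathIn` and its API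
(`SitePaths.lean`, `OneArmLSW.lean`), `PathIn.exists_arm_of_triNorm_le` (`ArmSeparationGlue.lean`),
`triOpenCircuit` (`OneArmLSW.lean`), `norm_triEmbed_le_triNorm`, `mul_triNorm_le_norm_triEmbed`,
`exists_abPathSystem_fin_of_forall_isVxSeparator`, `IsVxSeparator`, `ABPathSystem` (`Menger*.lean`).
Mathlib: `SimpleGraph.comap`, `SimpleGraph.Walk.map`, `Finset.card_le_card_of_injOn`.
-/

noncomputable section

open Set

namespace Literature.Probability.Percolation

open LatticeModels Literature.Combinatorics.SimpleGraph

/-! ### Pigeonhole for disjoint pieces -/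

/-- Fewer than `k` sites miss one of `k` pairwise disjoint sets of sites. [folklore] -/
theorem exists_forall_not_mem_of_card_lt {k : ℕ} (T : Fin k → Set (Site 2))
    (hT : Pairwise fun i j => Disjoint (T i) (T j)) (Z : Finset (Site 2)) (hZ : Z.card < k) :
    ∃ i, ∀ z ∈ Z, z ∉ T i := by
  classical
  by_contra h
  push Not at h
  choose z hzZ hzT using h
  have hinj : Function.Injective z := fun i j hij => by
    by_contra hne
    exact Set.disjoint_left.1 (hT hne) (hzT i) (hij ▸ hzT j)
  have hle : (Finset.univ : Finset (Fin k)).card ≤ Z.card :=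
    Finset.card_le_card_of_injOn z (fun i _ => hzZ i) (hinj.injOn)
  rw [Finset.card_univ, Fintype.card_fin] at hle
  omega

/-! ### The Menger step -/

/-- A `𝕋`-path inside `U ⊆ S` lifts to a walk of the subgraph of `𝕋` induced on the finite set `S`,
with the same sites. [folklore] -/
theorem exists_walk_comap_of_pathIn {S : Finset (Site 2)} {U : Set (Site 2)} (hUS : ∀ v ∈ U, v ∈ S)
    {a b : Site 2} (h : PathIn triGraph U a b) (ha : a ∈ S) (hb : b ∈ S) :
    ∃ w : (triGraph.comap (Subtype.val : {v // v ∈ S} → Site 2)).Walk ⟨a, ha⟩ ⟨b, hb⟩,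
      ∀ z ∈ w.support, z.1 ∈ U := by
  obtain ⟨haU, hab⟩ := h
  induction hab with
  | refl =>
    refine ⟨SimpleGraph.Walk.nil, fun z hz => ?_⟩
    rw [SimpleGraph.Walk.support_nil, List.mem_singleton] at hz
    rw [hz]
    exact haU
  | @tail c d hac hcd ih =>
    have hcU : c ∈ U := (show PathIn triGraph U a c from ⟨haU, hac⟩).right_mem
    obtain ⟨w, hw⟩ := ih (hUS c hcU)
    have hadj : (triGraph.comap (Subtype.val : {v // v ∈ S} → Site 2)).Adj ⟨c, hUS c hcU⟩ ⟨d, hb⟩ :=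
      hcd.1
    refine ⟨w.concat hadj, fun z hz => ?_⟩
    rw [SimpleGraph.Walk.support_concat, List.mem_append, List.mem_singleton] at hz
    rcases hz with hz | rfl
    · exact hw z hz
    · exact hcd.2

/-- **The Menger step.** If every set `Z` of fewer than `k` sites is avoided by some open `𝕋`-path of
the closed annulus `{n₁ ≤ |·|_𝕋 ≤ n₃}` from a site of `∂Λ_{n₁}` to a site of `∂Λ_{n₃}`, then there are
`k` pairwise vertex-disjoint open arms across `Λ_{n₃} ∖ Λ_{n₁}`: in the subgraph of `𝕋` induced on the
open sites of the annulus every `∂Λ_{n₁}`–`∂Λ_{n₃}` separator has at least `k` vertices, and Menger's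
theorem (`exists_abPathSystem_fin_of_forall_isVxSeparator`) gives the paths. [cite: Diestel2017, Thm. 3.3.1] [cite: Nolin2008, §4.5 Prop. 16 (arXiv 0711.4948: Prop. 15), σ constant] -/
theorem mem_armEvent_const_of_forall_link {k n₁ n₃ : ℕ} {ω : SiteConfig (Site 2)}
    (hlink : ∀ Z : Finset (Site 2), Z.card < k →
      ∃ (U : Set (Site 2)) (a b : Site 2), U ⊆ ω ∧
        (∀ v ∈ U, (n₁ : ℤ) ≤ triNorm v ∧ triNorm v ≤ n₃) ∧ (∀ v ∈ U, v ∉ Z) ∧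
        triNorm a = n₁ ∧ triNorm b = n₃ ∧ PathIn triGraph U a b) :
    ω ∈ armEvent (fun _ : Fin k => true) n₁ n₃ := by
  classical
  -- the subgraph of `𝕋` induced on the open sites of the closed annulus
  set S : Finset (Site 2) := (triAnnulus n₁ n₃).filter (fun v => v ∈ ω) with hS
  have hmemS : ∀ {v : Site 2}, v ∈ S ↔ ((n₁ : ℤ) ≤ triNorm v ∧ triNorm v ≤ n₃) ∧ v ∈ ω := by
    intro v; simp [hS, mem_triAnnulus]
  set H : SimpleGraph {v // v ∈ S} := triGraph.comap (Subtype.val : {v // v ∈ S} → Site 2) with hH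
  set A : Set {v // v ∈ S} := {v | triNorm v.1 = n₁} with hA
  set B : Set {v // v ∈ S} := {v | triNorm v.1 = n₃} with hB
  -- every `A`–`B` separator has at least `k` vertices
  have hsep : ∀ Z : Finset {v // v ∈ S}, IsVxSeparator H A B ↑Z → k ≤ Z.card := by
    intro Z hZ
    by_contra hlt
    push Not at hlt
    have hcard : (Z.map (Function.Embedding.subtype _)).card < k := by simpa using hlt
    obtain ⟨U, a, b, hUω, hUann, hUZ, ha, hb, hp⟩ := hlink _ hcard
    have hUS : ∀ v ∈ U, v ∈ S := fun v hv => hmemS.2 ⟨hUann v hv, hUω hv⟩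
    obtain ⟨w, hw⟩ := exists_walk_comap_of_pathIn hUS hp (hUS a hp.left_mem) (hUS b hp.right_mem)
    obtain ⟨z, hz, hzZ⟩ := hZ (show (⟨a, hUS a hp.left_mem⟩ : {v // v ∈ S}) ∈ A from ha)
      (show (⟨b, hUS b hp.right_mem⟩ : {v // v ∈ S}) ∈ B from hb) w
    refine hUZ z.1 (hw z hz) ?_
    exact Finset.mem_map.2 ⟨z, Finset.mem_coe.1 hzZ, rfl⟩
  obtain ⟨P⟩ := exists_abPathSystem_fin_of_forall_isVxSeparator H A B k hsep
  -- the `k` arms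
  let f : H →g triGraph := ⟨Subtype.val, fun h => h⟩
  have hf : Function.Injective f := Subtype.val_injective
  refine ⟨fun j => (P.fst ⟨j⟩).1, fun j => (P.lst ⟨j⟩).1, fun j => (P.walk ⟨j⟩).map f, fun j => ?_, ?_⟩
  · refine ⟨mem_triSphere_iff.2 (P.fst_mem ⟨j⟩), mem_triSphere_iff.2 (P.lst_mem ⟨j⟩),
      (SimpleGraph.Walk.isPath_map_iff_of_injective hf).2 (P.isPath ⟨j⟩), fun v hv => ?_, fun v hv => ?_⟩
    · rw [SimpleGraph.Walk.support_map, List.mem_map] at hv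
      obtain ⟨z, -, rfl⟩ := hv
      rw [show (f z : Site 2) = z.1 from rfl]
      obtain ⟨⟨h1, h2⟩, -⟩ := hmemS.1 z.2
      by_cases heq : triNorm z.1 = n₁
      · exact Or.inr (mem_triSphere_iff.2 heq)
      · refine Or.inl ⟨Finset.mem_coe.2 (mem_triBall_iff.2 h2), fun h => ?_⟩
        rw [Finset.mem_coe, mem_triBall_iff] at h
        omega
    · rw [SimpleGraph.Walk.support_map, List.mem_map] at hv
      obtain ⟨z, -, rfl⟩ := hv
      rw [show (f z : Site 2) = z.1 from rfl]
      simpa using (hmemS.1 z.2).2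
  · intro i j hij
    rw [Finset.disjoint_left]
    intro v hvi hvj
    rw [List.mem_toFinset, SimpleGraph.Walk.support_map, List.mem_map] at hvi hvj
    obtain ⟨zi, hzi, rfl⟩ := hvi
    obtain ⟨zj, hzj, hzij⟩ := hvj
    obtain rfl : zj = zi := Subtype.val_injective hzij
    exact P.disjoint ⟨i⟩ ⟨j⟩ (fun h => hij (congrArg ULift.down h)) hzi hzj

/-! ### Crossings of disjoint regions -/

/-- **`k` open paths inside `k` pairwise disjoint regions, each from `Λ_{n₁}` to the outside of
`Λ̊_{n₃}`, give `k` disjoint open arms across `Λ_{n₃} ∖ Λ_{n₁}`** (trimming,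
`PathIn.exists_arm_of_triNorm_le`, and the Menger step — here a set of fewer than `k` sites simply
misses one of the regions). [cite: Nolin2008, §4.1 (arXiv 0711.4948: p. 8, "we can then draw straight lines heading toward the exterior")] -/
theorem mem_armEvent_const_of_crossings {k n₁ n₃ : ℕ} (h13 : n₁ ≤ n₃) {ω : SiteConfig (Site 2)}
    (X : Fin k → Set (Site 2)) (hX : Pairwise fun i j => Disjoint (X i) (X j))
    (hcross : ∀ l, ∃ x y : Site 2, triNorm x ≤ n₁ ∧ (n₃ : ℤ) ≤ triNorm y ∧ PathIn triGraph (X l ∩ ω) x y) :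
    ω ∈ armEvent (fun _ : Fin k => true) n₁ n₃ := by
  refine mem_armEvent_const_of_forall_link fun Z hZ => ?_
  obtain ⟨l, hl⟩ := exists_forall_not_mem_of_card_lt X hX Z hZ
  obtain ⟨x, y, hx, hy, hp⟩ := hcross l
  obtain ⟨a, b, ha, hb, hq⟩ := hp.exists_arm_of_triNorm_le hx hy h13
  refine ⟨_, a, b, ?_, ?_, ?_, ha, hb, hq⟩
  · rintro v ⟨-, -, hv⟩; exact hv
  · rintro v ⟨hv, -⟩; exact hv
  · rintro v ⟨-, hvX, -⟩ hvZ; exact hl v hvZ hvX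

/-! ### Euclidean versus graph norm, dyadic annuli -/

/-- `17/10 < √3 < 2`. [folklore] -/
theorem sqrt_three_bounds : (17 / 10 : ℝ) < Real.sqrt 3 ∧ Real.sqrt 3 < 2 := by
  constructor
  · rw [Real.lt_sqrt (by norm_num)]; norm_num
  · rw [Real.sqrt_lt' (by norm_num)]; norm_num

/-- `‖v‖ ≤ t` as soon as `|v|_𝕋 ≤ t` (circle inside hexagon). [folklore] -/
theorem norm_triEmbed_le_of_triNorm_le {v : Site 2} {t : ℝ} (h : (triNorm v : ℝ) ≤ t) : ‖triEmbed v‖ ≤ t :=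
  (norm_triEmbed_le_triNorm v).trans h

/-- `t ≤ ‖v‖` as soon as `t ≤ (√3/2) |v|_𝕋` (hexagon inside circle). [folklore] -/
theorem le_norm_triEmbed_of_le {v : Site 2} {t : ℝ} (h : t ≤ Real.sqrt 3 / 2 * triNorm v) : t ≤ ‖triEmbed v‖ :=
  h.trans (mul_triNorm_le_norm_triEmbed v)

/-- `|v|_𝕋 < t` as soon as `‖v‖ < (√3/2) t`. [folklore] -/
theorem triNorm_lt_of_norm_lt {v : Site 2} {t : ℝ} (h : ‖triEmbed v‖ < Real.sqrt 3 / 2 * t) :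
    (triNorm v : ℝ) < t := by
  have h' := (mul_triNorm_le_norm_triEmbed v).trans_lt h
  have hpos : (0 : ℝ) < Real.sqrt 3 / 2 := by
    have := sqrt_three_bounds.1; positivity
  exact lt_of_mul_lt_mul_left h' hpos.le

/-- `t < |v|_𝕋` as soon as `t < ‖v‖`. [folklore] -/
theorem lt_triNorm_of_lt_norm {v : Site 2} {t : ℝ} (h : t < ‖triEmbed v‖) : t < (triNorm v : ℝ) :=
  h.trans_le (norm_triEmbed_le_triNorm v)

/-- Sets of sites in distinct dyadic Euclidean annuli `2^i R < ‖·‖ < 2^{i+1} R` are disjoint. [folklore] -/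
theorem disjoint_of_mem_dyadic {R : ℝ} (hR : 0 ≤ R) {i j : ℕ} (hij : i ≠ j) {S T : Set (Site 2)}
    (hS : ∀ z ∈ S, (2 : ℝ) ^ i * R < ‖triEmbed z‖ ∧ ‖triEmbed z‖ < (2 : ℝ) ^ (i + 1) * R)
    (hT : ∀ z ∈ T, (2 : ℝ) ^ j * R < ‖triEmbed z‖ ∧ ‖triEmbed z‖ < (2 : ℝ) ^ (j + 1) * R) :
    Disjoint S T := by
  rw [Set.disjoint_left]
  intro z hzS hzT
  obtain ⟨h1, h2⟩ := hS z hzS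
  obtain ⟨h3, h4⟩ := hT z hzT
  rcases lt_or_gt_of_ne hij with h | h
  · have hp : (2 : ℝ) ^ (i + 1) * R ≤ (2 : ℝ) ^ j * R :=
      mul_le_mul_of_nonneg_right (pow_le_pow_right₀ (by norm_num) (Nat.succ_le_of_lt h)) hR
    linarith
  · have hp : (2 : ℝ) ^ (j + 1) * R ≤ (2 : ℝ) ^ i * R :=
      mul_le_mul_of_nonneg_right (pow_le_pow_right₀ (by norm_num) (Nat.succ_le_of_lt h)) hR
    linarith

/-- The sites of a walk, as a set; every site of the walk is joined to every other one inside it. [folklore] -/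
theorem pathIn_support_of_mem {u v : Site 2} (w : triGraph.Walk u v) {z z' : Site 2}
    (hz : z ∈ w.support) (hz' : z' ∈ w.support) : PathIn triGraph {x | x ∈ w.support} z z' :=
  (PathIn.of_walk_mem_support w (fun _ hx => hx) hz).1.symm.trans
    (PathIn.of_walk_mem_support w (fun _ hx => hx) hz').1

/-- The supports of the arms of an arm event are pairwise disjoint as sets. [folklore] -/
theorem disjoint_support_sets_of_pairwise {k : ℕ} {x y : Fin k → Site 2}
    {w : ∀ j, triGraph.Walk (x j) (y j)}
    (h : Pairwise fun i j => Disjoint (w i).support.toFinset (w j).support.toFinset) :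
    Pairwise fun i j => Disjoint {z | z ∈ (w i).support} {z | z ∈ (w j).support} := by
  intro i j hij
  rw [Set.disjoint_left]
  intro z hzi hzj
  exact Finset.disjoint_left.1 (h hij) (List.mem_toFinset.2 hzi) (List.mem_toFinset.2 hzj)

/-! ### The gluing -/

/-- **Gluing monochromatic arms through circuits and connectors.** Let `n₁ ≤ R₀`,
`2^k R₀ ≤ (√3/2) n₂`, `n₂ ≤ N ≤ n₃` and `2^k n₂ ≤ (√3/2) N`. Suppose `ω` has `k` disjoint open arms
across `Λ_{n₂} ∖ Λ_{n₁}` and `k` across `Λ_{n₃} ∖ Λ_{n₂}`, open circuits in the `k` Euclidean annuli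
`2^j R₀ < ‖·‖ < 2^{j+1} R₀` and in the `k` annuli `2^j n₂ < ‖·‖ < 2^{j+1} n₂` (`j < k`), and, inside
`k` pairwise disjoint regions, open paths from `Λ_{R₀}` to the outside of `Λ̊_N`. Then `ω` has `k`
disjoint open arms across `Λ_{n₃} ∖ Λ_{n₁}`: a set of `k - 1` sites misses an inner arm, an inner
circuit, a connector, an outer circuit and an outer arm, and these five open pieces meet
consecutively (every inner arm and every connector crosses every inner circuit, every connector and
every outer arm crosses every outer circuit), so their union joins `∂Λ_{n₁}` to `∂Λ_{n₃}` off the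
`k - 1` sites; conclude by the Menger step. This replaces, for one colour, the separation/gluing of
Nolin's proof of Prop. 16 (arXiv) by Harris-type monotone gluing. [cite: Nolin2008, §4.5 Prop. 16 (arXiv 0711.4948: Prop. 15–16), σ constant; §6.2 footnote 5] [cite: Diestel2017, Thm. 3.3.1] -/
theorem mem_armEvent_const_glue {k n₁ n₂ n₃ R₀ N : ℕ} {ω : SiteConfig (Site 2)}
    (h12 : n₁ ≤ n₂) (h23 : n₂ ≤ n₃) (h01 : n₁ ≤ R₀)
    (hR₀ : (2 : ℝ) ^ k * R₀ ≤ Real.sqrt 3 / 2 * n₂) (h2N : n₂ ≤ N) (hN3 : N ≤ n₃)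
    (hN : (2 : ℝ) ^ k * n₂ ≤ Real.sqrt 3 / 2 * N)
    (hin : ω ∈ armEvent (fun _ : Fin k => true) n₁ n₂)
    (hout : ω ∈ armEvent (fun _ : Fin k => true) n₂ n₃)
    (hcin : ∀ j < k, ω ∈ triOpenCircuit ((2 : ℝ) ^ j * R₀) ((2 : ℝ) ^ (j + 1) * R₀))
    (hcout : ∀ j < k, ω ∈ triOpenCircuit ((2 : ℝ) ^ j * n₂) ((2 : ℝ) ^ (j + 1) * n₂))
    (X : Fin k → Set (Site 2)) (hX : Pairwise fun i j => Disjoint (X i) (X j))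
    (hconn : ∀ l, ∃ x y : Site 2, triNorm x ≤ R₀ ∧ (N : ℤ) ≤ triNorm y ∧ PathIn triGraph (X l ∩ ω) x y) :
    ω ∈ armEvent (fun _ : Fin k => true) n₁ n₃ := by
  classical
  obtain ⟨hs1, hs2⟩ := sqrt_three_bounds
  have hs0 : (0 : ℝ) < Real.sqrt 3 / 2 := by positivity
  have hsle : Real.sqrt 3 / 2 ≤ 1 := by linarith
  have hR₀0 : (0 : ℝ) ≤ R₀ := Nat.cast_nonneg _
  have hn₂0 : (0 : ℝ) ≤ n₂ := Nat.cast_nonneg _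
  have h2k1 : (1 : ℝ) ≤ 2 ^ k := one_le_pow₀ (by norm_num)
  have hpow : ∀ {j : ℕ}, j < k → (2 : ℝ) ^ (j + 1) ≤ 2 ^ k := fun hj =>
    pow_le_pow_right₀ (by norm_num) (Nat.succ_le_of_lt hj)
  have hpow1 : ∀ j : ℕ, (1 : ℝ) ≤ 2 ^ j := fun j => one_le_pow₀ (by norm_num)
  -- consequences of the numeric hypotheses
  have hR₀N : (R₀ : ℝ) ≤ N := by
    have : (R₀ : ℝ) ≤ 2 ^ k * R₀ := le_mul_of_one_le_left hR₀0 h2k1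
    nlinarith
  have hR₀n₂ : (R₀ : ℝ) ≤ n₂ := by
    have : (R₀ : ℝ) ≤ 2 ^ k * R₀ := le_mul_of_one_le_left hR₀0 h2k1
    nlinarith
  refine mem_armEvent_const_of_forall_link fun Z hZ => ?_
  -- the pieces
  obtain ⟨xP, yP, wP, hwP, hdP⟩ := hin
  obtain ⟨xQ, yQ, wQ, hwQ, hdQ⟩ := hout
  choose vC wC hwC hsC using fun j : Fin k => hcin j j.2
  choose vD wD hwD hsD using fun j : Fin k => hcout j j.2
  -- trimmed connectors
  have hconn' : ∀ l, ∃ x y : Site 2, triNorm x = R₀ ∧ triNorm y = N ∧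
      PathIn triGraph ({w : Site 2 | (R₀ : ℤ) ≤ triNorm w ∧ triNorm w ≤ N} ∩ (X l ∩ ω)) x y := by
    intro l
    obtain ⟨x, y, hx, hy, hp⟩ := hconn l
    exact hp.exists_arm_of_triNorm_le hx hy (by exact_mod_cast hR₀N)
  choose xX yX hxX hyX hpX using hconn'
  have hwX : ∀ l, ∃ w : triGraph.Walk (xX l) (yX l),
      ∀ z ∈ w.support, z ∈ {w : Site 2 | (R₀ : ℤ) ≤ triNorm w ∧ triNorm w ≤ N} ∩ (X l ∩ ω) :=
    fun l => (hpX l).exists_walk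
  choose wX hwX using hwX
  -- one piece of each family off `Z`
  obtain ⟨i, hi⟩ := exists_forall_not_mem_of_card_lt (fun i => {z | z ∈ (wP i).support})
    (disjoint_support_sets_of_pairwise hdP) Z hZ
  obtain ⟨r, hr⟩ := exists_forall_not_mem_of_card_lt (fun i => {z | z ∈ (wQ i).support})
    (disjoint_support_sets_of_pairwise hdQ) Z hZ
  obtain ⟨j, hj⟩ := exists_forall_not_mem_of_card_lt (fun j => {z | z ∈ (wC j).support})
    (fun a b hab => disjoint_of_mem_dyadic hR₀0 (Fin.val_ne_of_ne hab)
      (fun z hz => (hwC a z hz).2) (fun z hz => (hwC b z hz).2)) Z hZ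
  obtain ⟨m, hm⟩ := exists_forall_not_mem_of_card_lt (fun j => {z | z ∈ (wD j).support})
    (fun a b hab => disjoint_of_mem_dyadic hn₂0 (Fin.val_ne_of_ne hab)
      (fun z hz => (hwD a z hz).2) (fun z hz => (hwD b z hz).2)) Z hZ
  obtain ⟨l, hl⟩ := exists_forall_not_mem_of_card_lt X hX Z hZ
  -- norms of the endpoints
  obtain ⟨hxPi, hyPi, -, hsuppP, hcolP⟩ := hwP i
  obtain ⟨hxQr, hyQr, -, hsuppQ, hcolQ⟩ := hwQ r
  have exP : (triNorm (xP i) : ℝ) = n₁ := by exact_mod_cast mem_triSphere_iff.1 hxPi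
  have eyP : (triNorm (yP i) : ℝ) = n₂ := by exact_mod_cast mem_triSphere_iff.1 hyPi
  have exQ : (triNorm (xQ r) : ℝ) = n₂ := by exact_mod_cast mem_triSphere_iff.1 hxQr
  have eyQ : (triNorm (yQ r) : ℝ) = n₃ := by exact_mod_cast mem_triSphere_iff.1 hyQr
  have exX : (triNorm (xX l) : ℝ) = R₀ := by exact_mod_cast hxX l
  have eyX : (triNorm (yX l) : ℝ) = N := by exact_mod_cast hyX l
  have h01' : (n₁ : ℝ) ≤ R₀ := by exact_mod_cast h01
  have h2N' : (n₂ : ℝ) ≤ N := by exact_mod_cast h2N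
  have hN3' : (N : ℝ) ≤ n₃ := by exact_mod_cast hN3
  have hjR : (2 : ℝ) ^ (j : ℕ) * R₀ ≥ R₀ := le_mul_of_one_le_left hR₀0 (hpow1 j)
  have hjR' : (2 : ℝ) ^ ((j : ℕ) + 1) * R₀ ≤ Real.sqrt 3 / 2 * n₂ :=
    (mul_le_mul_of_nonneg_right (hpow j.2) hR₀0).trans hR₀
  have hmR : (2 : ℝ) ^ (m : ℕ) * n₂ ≥ n₂ := le_mul_of_one_le_left hn₂0 (hpow1 m)
  have hmR' : (2 : ℝ) ^ ((m : ℕ) + 1) * n₂ ≤ Real.sqrt 3 / 2 * N :=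
    (mul_le_mul_of_nonneg_right (hpow m.2) hn₂0).trans hN
  -- the four meeting sites
  obtain ⟨z₁, hz₁P, hz₁C⟩ := hsC j (xP i) (yP i) (wP i)
    (norm_triEmbed_le_of_triNorm_le (by rw [exP]; linarith))
    (le_norm_triEmbed_of_le (by rw [eyP]; linarith))
  obtain ⟨z₂, hz₂X, hz₂C⟩ := hsC j (xX l) (yX l) (wX l)
    (norm_triEmbed_le_of_triNorm_le (by rw [exX]; linarith))
    (le_norm_triEmbed_of_le (by rw [eyX]; nlinarith))
  obtain ⟨z₃, hz₃X, hz₃D⟩ := hsD m (xX l) (yX l) (wX l)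
    (norm_triEmbed_le_of_triNorm_le (by rw [exX]; nlinarith))
    (le_norm_triEmbed_of_le (by rw [eyX]; linarith))
  obtain ⟨z₄, hz₄Q, hz₄D⟩ := hsD m (xQ r) (yQ r) (wQ r)
    (norm_triEmbed_le_of_triNorm_le (by rw [exQ]; linarith))
    (le_norm_triEmbed_of_le (by rw [eyQ]; nlinarith))
  -- the union of the five pieces
  set UP : Set (Site 2) := {z | z ∈ (wP i).support} with hUP
  set UC : Set (Site 2) := {z | z ∈ (wC j).support} with hUC
  set UX : Set (Site 2) := {z | z ∈ (wX l).support} with hUX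
  set UD : Set (Site 2) := {z | z ∈ (wD m).support} with hUD
  set UQ : Set (Site 2) := {z | z ∈ (wQ r).support} with hUQ
  refine ⟨UP ∪ UC ∪ UX ∪ UD ∪ UQ, xP i, yQ r, ?_, ?_, ?_, mem_triSphere_iff.1 hxPi,
    mem_triSphere_iff.1 hyQr, ?_⟩
  · -- open
    rintro v ((((hv | hv) | hv) | hv) | hv)
    · simpa using hcolP v hv
    · exact (hwC j v hv).1
    · exact (hwX l v hv).2.2
    · exact (hwD m v hv).1
    · simpa using hcolQ v hv
  · -- inside the closed annulus
    rintro v ((((hv | hv) | hv) | hv) | hv)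
    · have := mem_triAnnulus.1 (mem_triAnnulus_of_arm h12 (hsuppP v hv))
      exact ⟨this.1, this.2.trans (by exact_mod_cast h23)⟩
    · obtain ⟨-, hv1, hv2⟩ := hwC j v hv
      have hlo : (n₁ : ℝ) < triNorm v := lt_triNorm_of_lt_norm (by linarith)
      have hhi : (triNorm v : ℝ) < n₂ := triNorm_lt_of_norm_lt (by linarith)
      constructor
      · exact_mod_cast hlo.le
      · have : (triNorm v : ℝ) ≤ n₃ := hhi.le.trans (by exact_mod_cast h23)
        exact_mod_cast this
    · obtain ⟨⟨hv1, hv2⟩, -⟩ := hwX l v hv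
      constructor <;> omega
    · obtain ⟨-, hv1, hv2⟩ := hwD m v hv
      have hlo : (n₁ : ℝ) < triNorm v :=
        lt_triNorm_of_lt_norm (by have : (n₁ : ℝ) ≤ n₂ := (by exact_mod_cast h12); linarith)
      have hhi : (triNorm v : ℝ) < n₃ := triNorm_lt_of_norm_lt (by nlinarith)
      constructor
      · exact_mod_cast hlo.le
      · exact_mod_cast hhi.le
    · have := mem_triAnnulus.1 (mem_triAnnulus_of_arm h23 (hsuppQ v hv))
      exact ⟨(show (n₁ : ℤ) ≤ n₂ by exact_mod_cast h12).trans this.1, this.2⟩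
  · -- off `Z`
    rintro v ((((hv | hv) | hv) | hv) | hv) hvZ
    · exact hi v hvZ hv
    · exact hj v hvZ hv
    · exact hl v hvZ (hwX l v hv).2.1
    · exact hm v hvZ hv
    · exact hr v hvZ hv
  · -- the chain `xP i → z₁ → z₂ → z₃ → z₄ → yQ r`
    have s1 : UP ⊆ UP ∪ UC ∪ UX ∪ UD ∪ UQ := fun v hv => Or.inl (Or.inl (Or.inl (Or.inl hv)))
    have s2 : UC ⊆ UP ∪ UC ∪ UX ∪ UD ∪ UQ := fun v hv => Or.inl (Or.inl (Or.inl (Or.inr hv)))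
    have s3 : UX ⊆ UP ∪ UC ∪ UX ∪ UD ∪ UQ := fun v hv => Or.inl (Or.inl (Or.inr hv))
    have s4 : UD ⊆ UP ∪ UC ∪ UX ∪ UD ∪ UQ := fun v hv => Or.inl (Or.inr hv)
    have s5 : UQ ⊆ UP ∪ UC ∪ UX ∪ UD ∪ UQ := fun v hv => Or.inr hv
    have p1 : PathIn triGraph UP (xP i) z₁ := pathIn_support_of_mem (wP i) (wP i).start_mem_support hz₁P
    have p2 : PathIn triGraph UC z₁ z₂ := pathIn_support_of_mem (wC j) hz₁C hz₂C
    have p3 : PathIn triGraph UX z₂ z₃ := pathIn_support_of_mem (wX l) hz₂X hz₃X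
    have p4 : PathIn triGraph UD z₃ z₄ := pathIn_support_of_mem (wD m) hz₃D hz₄D
    have p5 : PathIn triGraph UQ z₄ (yQ r) := pathIn_support_of_mem (wQ r) hz₄Q (wQ r).end_mem_support
    exact ((((p1.mono s1).trans (p2.mono s2)).trans (p3.mono s3)).trans (p4.mono s4)).trans (p5.mono s5)

end Literature.Probability.Percolation
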